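import Literature.AnabelianGeometry.EtaleTheta.ClassicalTheta
import Literature.AnabelianGeometry.EtaleTheta.CyclotomicEnvelope

/-!
# Kernel DAG index — layer L2, part a (MACHINE DRAFT by abc-iut-dag `tools/mkkernel.py`, index v0 of plan/DAG.tsv @2026-08-25T18:35Z, 5 nodes)

THIS FILE PROVES NOTHING NEW AND ASSERTS NOTHING (plan/KERNEL-DAG-SPEC.md). It gives ONE NAME `N_<kernel_id>` to each DAG node whose
statement has LANDED through the gate, knitting the landed declarations BY NAME; `N_<id>_holds` exists iff the node's printed claims are
theorems OUR kernel checked (it IS those theorems); FACT-style `def … : Prop` claims and `@[claim … "disputed"]` items get a name and no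
`_holds`. Nothing here says abc is proved or refuted or takes a side on [IUTchIII] Cor 3.12. typed ≠ discharged; indexed ≠ endorsed.
Filer of the tree copy: abc-iut-c312-2 (`Summits/ABC/IUTFork/DAGL2a.lean`); this draft is regenerated hourly and is not the tree.
FILED COPY (abc-iut-c312-2, post-processed by work/fixdraft.py): claim nodes are claim-form abbrevs without `_holds`;
`_holds` only for DAG rows marked discharged, `_part` otherwise (spec §2(b),(c)); edges by name (§3).
-/

namespace Summit.ABC.IUTFork.DAG

namespace PartL2a
/-- `StatementOf h` is the statement (a `Prop`) of which the landed `h` is the proof: the index NAMES statements, it never re-types them. -/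
abbrev StatementOf {P : Prop} (_h : P) : Prop := P
end PartL2a
open PartL2a

noncomputable section
universe u₁ u₂ u₃ u₄ u₅ u₆ u₇ u₈ u₉

/-- [node EtTh:Prop1.4(i) · L2/D1 · [EtTh] Prop 1.4 (i), kurims-ms p.20 · p403763 · claim] decls 5 · cites→ EtTh:Prop1.3 -/
def N_EtTh_Prop1_4_i : Prop :=
  StatementOf @Literature.AnabelianGeometry.EtaleTheta.thetaDdot_zpow.{u₁} ∧
  StatementOf @Literature.AnabelianGeometry.EtaleTheta.thetaDdot_neg_zpow.{u₁} ∧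
  StatementOf @Literature.AnabelianGeometry.EtaleTheta.thetaDdot_eq_zero_iff_complex
/-- partial witness (DAG row not marked discharged) of `N_EtTh_Prop1_4_i`: the landed theorems it names, BY NAME (spec §2(c)); proves nothing new. -/
theorem N_EtTh_Prop1_4_i_part : N_EtTh_Prop1_4_i := ⟨@Literature.AnabelianGeometry.EtaleTheta.thetaDdot_zpow, @Literature.AnabelianGeometry.EtaleTheta.thetaDdot_neg_zpow, @Literature.AnabelianGeometry.EtaleTheta.thetaDdot_eq_zero_iff_complex⟩
example := @Literature.AnabelianGeometry.EtaleTheta.ThetaDdotZeroLocus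
example := @Literature.AnabelianGeometry.EtaleTheta.ThetaDdotSimpleZeros

/-- [node EtTh:Prop1.4(ii) · L2/D1 · [EtTh] Prop 1.4 (ii), kurims-ms p.20 · p403763 · claim] decls 6 · cites→ EtTh:Prop1.3 -/
def N_EtTh_Prop1_4_ii : Prop :=
  StatementOf @Literature.AnabelianGeometry.EtaleTheta.thetaDdotTerm_inv_neg_succ.{u₁} ∧
  StatementOf @Literature.AnabelianGeometry.EtaleTheta.thetaDdotTerm_neg.{u₁} ∧
  StatementOf @Literature.AnabelianGeometry.EtaleTheta.thetaDdotTerm_shift.{u₁} ∧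
  StatementOf @Literature.AnabelianGeometry.EtaleTheta.thetaDdot_inv.{u₁} ∧
  StatementOf @Literature.AnabelianGeometry.EtaleTheta.thetaDdot_neg.{u₁} ∧
  StatementOf @Literature.AnabelianGeometry.EtaleTheta.thetaDdot_zpow_mul.{u₁}
/-- partial witness (DAG row not marked discharged) of `N_EtTh_Prop1_4_ii`: the landed theorems it names, BY NAME (spec §2(c)); proves nothing new. -/
theorem N_EtTh_Prop1_4_ii_part : N_EtTh_Prop1_4_ii := ⟨@Literature.AnabelianGeometry.EtaleTheta.thetaDdotTerm_inv_neg_succ, @Literature.AnabelianGeometry.EtaleTheta.thetaDdotTerm_neg, @Literature.AnabelianGeometry.EtaleTheta.thetaDdotTerm_shift, @Literature.AnabelianGeometry.EtaleTheta.thetaDdot_inv, @Literature.AnabelianGeometry.EtaleTheta.thetaDdot_neg, @Literature.AnabelianGeometry.EtaleTheta.thetaDdot_zpow_mul⟩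

/-- [node EtTh:Def2.10 · L2/D1 · [EtTh] Def 2.10, kurims-ms p.40 · p403739 · claim] decls 17 · cites→ - -/
def N_EtTh_Def2_10 : Prop :=
  StatementOf @Literature.AnabelianGeometry.EtaleTheta.CycEnvelope.proj_comp_algSection.{u₁, u₂, u₃} ∧
  StatementOf @Literature.AnabelianGeometry.EtaleTheta.CycEnvelope.proj_surjective.{u₁, u₂, u₃} ∧
  StatementOf @Literature.AnabelianGeometry.EtaleTheta.CycEnvelope.ker_proj_eq_range_inMu.{u₁, u₂, u₃} ∧
  StatementOf @Literature.AnabelianGeometry.EtaleTheta.CycEnvelope.toFiber_apply.{u₁, u₂, u₃} ∧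
  StatementOf @Literature.AnabelianGeometry.EtaleTheta.CycEnvelope.mem_deltaEnv_iff.{u₁, u₂, u₃} ∧
  StatementOf @Literature.AnabelianGeometry.EtaleTheta.CycEnvelope.self_mem_muConjClass.{u₁, u₂, u₃}
/-- partial witness (DAG row not marked discharged) of `N_EtTh_Def2_10`: the landed theorems it names, BY NAME (spec §2(c)); proves nothing new. -/
theorem N_EtTh_Def2_10_part : N_EtTh_Def2_10 := ⟨@Literature.AnabelianGeometry.EtaleTheta.CycEnvelope.proj_comp_algSection, @Literature.AnabelianGeometry.EtaleTheta.CycEnvelope.proj_surjective, @Literature.AnabelianGeometry.EtaleTheta.CycEnvelope.ker_proj_eq_range_inMu, @Literature.AnabelianGeometry.EtaleTheta.CycEnvelope.toFiber_apply, @Literature.AnabelianGeometry.EtaleTheta.CycEnvelope.mem_deltaEnv_iff, @Literature.AnabelianGeometry.EtaleTheta.CycEnvelope.self_mem_muConjClass⟩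
example := @Literature.AnabelianGeometry.EtaleTheta.CycEnvelope
example := @Literature.AnabelianGeometry.EtaleTheta.CycEnvelope.proj
example := @Literature.AnabelianGeometry.EtaleTheta.CycEnvelope.toG
example := @Literature.AnabelianGeometry.EtaleTheta.CycEnvelope.inMu
example := @Literature.AnabelianGeometry.EtaleTheta.CycEnvelope.fiberProd
example := @Literature.AnabelianGeometry.EtaleTheta.CycEnvelope.toFiber

/-- [node EtTh:Prop2.11(i) · L2/D1 · [EtTh] Prop 2.11 (i), kurims-ms p.41 · p403739 · claim] decls 5 · cites→ - -/
def N_EtTh_Prop2_11_i : Prop :=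
  StatementOf @Literature.AnabelianGeometry.EtaleTheta.CycEnvelope.commute_iff_of_mem_deltaEnv.{u₁, u₂, u₃} ∧
  StatementOf @Literature.AnabelianGeometry.EtaleTheta.CycEnvelope.central_in_deltaEnv_iff.{u₁, u₂, u₃} ∧
  StatementOf @Literature.AnabelianGeometry.EtaleTheta.CycEnvelope.center_deltaEnv_eq.{u₁, u₂, u₃} ∧
  StatementOf @Literature.AnabelianGeometry.EtaleTheta.CycEnvelope.map_center_eq_of_equiv.{u₁, u₂} ∧
  StatementOf @Literature.AnabelianGeometry.EtaleTheta.CycEnvelope.map_equiv_ker_eq.{u₁, u₂, u₃, u₄, u₅, u₆}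
/-- partial witness (DAG row not marked discharged) of `N_EtTh_Prop2_11_i`: the landed theorems it names, BY NAME (spec §2(c)); proves nothing new. -/
theorem N_EtTh_Prop2_11_i_part : N_EtTh_Prop2_11_i := ⟨@Literature.AnabelianGeometry.EtaleTheta.CycEnvelope.commute_iff_of_mem_deltaEnv, @Literature.AnabelianGeometry.EtaleTheta.CycEnvelope.central_in_deltaEnv_iff, @Literature.AnabelianGeometry.EtaleTheta.CycEnvelope.center_deltaEnv_eq, @Literature.AnabelianGeometry.EtaleTheta.CycEnvelope.map_center_eq_of_equiv, @Literature.AnabelianGeometry.EtaleTheta.CycEnvelope.map_equiv_ker_eq⟩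

/-- [node EtTh:Prop2.14(ii) · L2/D1 · [EtTh] Prop 2.14 (ii), kurims-ms p.45 · p403739 · claim] decls 4 · cites→ EtTh:Cor2.9,EtTh:Prop2.11 -/
def N_EtTh_Prop2_14_ii : Prop :=
  StatementOf @Literature.AnabelianGeometry.EtaleTheta.CycEnvelope.proj_shift.{u₁, u₂, u₃} ∧
  StatementOf @Literature.AnabelianGeometry.EtaleTheta.CycEnvelope.shift_inMu.{u₁, u₂, u₃}
/-- partial witness (DAG row not marked discharged) of `N_EtTh_Prop2_14_ii`: the landed theorems it names, BY NAME (spec §2(c)); proves nothing new. -/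
theorem N_EtTh_Prop2_14_ii_part : N_EtTh_Prop2_14_ii := ⟨@Literature.AnabelianGeometry.EtaleTheta.CycEnvelope.proj_shift, @Literature.AnabelianGeometry.EtaleTheta.CycEnvelope.shift_inMu⟩
example := @Literature.AnabelianGeometry.EtaleTheta.CycEnvelope.IsEnvCocycle
example := @Literature.AnabelianGeometry.EtaleTheta.CycEnvelope.shift

end

end Summit.ABC.IUTFork.DAG
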